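import Summits.ResolutionOfSingularities.ResolutionOfSingularities.Theses.JacobianBudget
import Summits.ResolutionOfSingularities.ResolutionOfSingularities.Theorems.IsolatedJacobianDrop.Negative.FalseWithoutMultP
import Summits.ResolutionOfSingularities.ResolutionOfSingularities.Theorems.IsolatedJacobianDrop.Negative.FalseWithoutIsol
import Summits.ResolutionOfSingularities.ResolutionOfSingularities.Theorems.IsolatedJacobianDrop.Negative.TightN1

/-!
# Disproof of `IsolatedJacobianDrop` (stmt-ResolutionOfSingularities-18946) — findings

Seat `refuter-cdisprove-stmt-ResolutionOfSingularities-18946-0`, cycle 1 (2026-08-17), v2.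
**Verdict of the cycle: NO KILL — the crux is a theorem of intersection theory; it resists every
attack for a structural reason (§4), and all six stubs of line `euler-noether` are TRUE AS TYPED (§5).**
LANDED this cycle under `Theorems/IsolatedJacobianDrop/Negative/` (all sorry-free, standard axioms,
`--supports` this item; imported below, so §0–§2 are one-liners here):
`FalseWithoutMultP.lean` (p169270, commit b091a0538a57), `TightN1.lean` (p169511, e69f509bcfe5),
`FalseWithoutIsol.lean` (p169832, d95099b50fff).

* §0  `crux_iff` — the crux is DEFINITIONALLY the displayed proposition over the landed mirror
  calculus `clean bl ord dv tr step run ser pd jac` of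
  `Theorems/NoPeriodicIsolatedAtom/Negative/FalseWithoutIsol.lean` (`Iff.rfl`), so every negative
  lemma is literally about the crux's own `let`-block.
* §1  LOAD-BEARING ANALYSIS (hypothesis by hypothesis):
  - `MultP (run m)`   LOAD-BEARING — `isolatedJacobianDrop_false_without_MultP` (LANDED): witness
    `(p,n,κ)=(2,2,𝔽₂)`, smooth `x ↦` (no division at cleaned order `1 < 2`) total transform `xy`,
    `μ: 0 → 1`, `Δ₂(2) = 1`: `1 + 1 ≰ 0`.  Below multiplicity `p` the typed dynamics does not divide
    and `μ` can INCREASE.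
  - `Isol (run m)`    LOAD-BEARING — `isolatedJacobianDrop_false_without_Isol` (LANDED): witness
    `(2,2,𝔽₂)`, Whitney umbrella `x²y` (multiplicity `2`, singular along the `y`-axis, `μ = ∞` — proved
    `¬ Module.Finite`, the classes of `y^k` are independent mod `(x²)` — junk `finrank = 0`) `↦`
    (x-chart, `τ = 0`) `xy` (isolated, `MultP`, `μ = 1`): `1 + Δ₂(2) ≰ 0`.  Isolatedness is not
    inherited backwards along the dynamics; the conservation law needs `μ_P < ∞` on the nose.
    Paper twin at `p = 3`: `x²y²+y⁷ ↦ x²y+y⁴`, `μ: ∞ ↦ 5`.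
  - `Isol (run (m+1))` FORMALLY DROPPABLE (junk): without it `mu (m+1) = 0` and the claim is
    `Δ_n(p) ≤ μ_P`, true by the weighted-order bound `μ_P ≥ (p-1)^{n-1}(2p-1) ≥ Δ_n(p)` at every
    state with a `MultP` successor (weights `(2,…,2,1)` adapted to the successor direction, weighted
    Bezout).  Not a weakness: it is what makes the conclusion non-vacuous.
  - `MultP (run (m+1))` DROPPABLE for `n ≤ 2` and `(n,p) = (3,3)` (then `Z(da') ∩ E` is finite as
    soon as `Q` is isolated); PROBABLY NOT LOAD-BEARING for the inequality in general, but consumed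
    ESSENTIALLY by `NoExcess` (ExcFinite genuinely fails without it).  Evidence (kit j026969, exact,
    attached to the item): `p = 5`, `n = 3`, `F = (u₁²+u₂²+u₃²)² u₁` (cleaned), `G = q·h` with
    `h(1,0,0) = 0`, random `F₇, F₈` over `𝔽₅`: `P(Crit F) = conic ∪ {R = (1:0:0)}`, the whole conic
    lies in `Z(da') ∩ E` (EXCESS) and `R` is an isolated NON-`MultP` successor (cleaned order `2`);
    measured `μ_P = 120`, `μ_R = 1`, so `μ_R + Δ₃(5) = 78 ≤ 120` holds with slack `42` = the excess
    contribution of the conic, POSITIVE (a violation needs a negative excess contribution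
    `{c(Ω(-pE)|_Z) s(Z,Y')}_0`; for a reduced plane curve of degree `d ≤ p+1` it is
    `d(3p-1-d) > 0`, here the conic carries a thicker structure, `42 > 24`).  kit j027030 (attached):
    seeds 2–4 give `μ_P ∈ {118,120}`, `μ_R = 1`, slack `40–42`; `p = 7` (`F = q³u₁`): `μ_P = 322`,
    `μ_R = 2`, `Δ₃(7) = 247`, slack `73`; `p = 3` (`F = qu₁`, no excess, `K` finite): `μ_P = 16`,
    `μ_R = 3`, `Δ₃(3) = 11`, slack `2` — the inequality holds WITHOUT `MultP(m+1)` in every probe.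
  - `[PerfectField κ]` NOT USED by the conservation-law proof (`μ` is invariant under ground-field
    extension, the successor is `κ`-rational by construction).  `p.Prime` is used only as
    `p ≠ 0, 1` (junk `p = 0`: `Δ = 0`, cleaning deletes only constants, no division; `x ↦ xy` again
    gives `1 ≤ 0`; not restated).  `0 < n`: at `n = 0` the statement is vacuous.
* §2  TIGHTNESS (the constant cannot be improved): `isolatedJacobianDrop_tight_n1` (LANDED):
  `(2,1,𝔽₂)`, `u⁵ ↦ u³`, all four hypotheses hold, `μ: 4 ↦ 2 = Δ₁(2)` EXACTLY (in the crux's own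
  arithmetic), and the conclusion with `Δ + 1` fails; helper `finrank_quot_X_pow`:
  `dim κ[[u]] ⧸ (u^k) = k`.  General `n = 1`: `u^d ↦ u^{d-p}`, slack `0` at EVERY transition.
  `(p,n) = (3,2)`: `u₀⁴+u₁⁷ → u₀⁴u₁+u₁⁴ → u₀²u₁+u₀u₁⁴`, `μ: 18 → 13 → 8`, two consecutive slack-0
  steps, the successor being the only zero of `da'` on `E` each time (`tight_32`, sorried specimen:
  colengths certified by the item's censuses, not `decide`-able).
* §3  NATURAL STRENGTHENINGS refuted on paper: "the drop is EXACTLY `Δ_n(p)`" is false pointwise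
  (`p=3,n=2`, `u₀²u₁²+u₁⁷+u₀⁵`: `μ = 13`, successor `μ = 5`, the other exceptional zero carries `3`:
  `5 + 3 + 5 = 13`) — the identity lives on the SUM over `E` (`ExceptionalBudget` in equality form);
  "μ is monotone along arbitrary steps" is false (§1, `0 → 1`).  Specimen `not_pointwise_equality`
  (sorried, colengths by census).
* §4  WHY IT RESISTS (the obstruction to any counterexample = the proof): with `ω = da`,
  `ω' = da' = e^{-p} π^*ω` is a regular section of `Ω_{Y'}(-pE)` (char `p`: `d(e^{-p}g) = e^{-p}dg`);
  localized top Chern classes (Fulton 14.1) on `Bl_P 𝐏ⁿ` after algebraising `a` (finite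
  determinacy at the finitely many zeros) give, WHENEVER `Z(ω') ∩ E` is finite,
  `Σ_{Q'∈E} length_{Q'} Z(ω') = μ_P − Δ_n(p)`, `Δ_n(p) = −deg_E [c(Ω_{Y'}) ⊗ O(−pE)]_n`-correction
  `= ((p−1)ⁿ(p+1) − (−1)ⁿ)/p` (re-derived: `[Ω_{Y'}] = π^*[Ω_Y] + [i_*Ω_E]`, Euler sequence on
  `E = 𝐏ⁿ⁻¹`, `c(Ω_{Y'}) = π^*c(Ω_Y)(1+E)ⁿ(1−E)`, `Eⁿ = (−1)ⁿ⁻¹`, the truncation of `(1+x)ⁿ(1−x)`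
  at `xⁿ` supplies the `−(−1)ⁿ`; checked at `n = 2` — the classical DICRITICAL blow-up formula for
  foliations with `ν = p−1`, `ν²+ν−1 = p²−p−1` — and `n = 3`, `p³−2p²+2`, `Δ₃(3) = 11`).
  NO EXCESS: `MultP(Q)` ⇔ `a' − a'(Q) ∈ 𝔪_Q^p` ⇔ `F_p = c uₙ^p + H(u' − τuₙ)` and
  `deg_{wₙ} F_{p+k} ≤ 2k`; so `K = P(Crit F_p)` is the cone with vertex `Q` over `P(Crit H)`,
  `Z(ω') ∩ E = K ∩ V(F_{p+1})` with `F_{p+1}(Q) = 0`; a component of `K` of dimension `≥ 2` meets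
  `V(F_{p+1})` in a curve THROUGH `Q` (Krull) — contradicting `Isol(Q)`; so `dim K ≤ 1` and
  `K ∩ V(F_{p+1})` is `{Q}` plus `≤ 2` points on each of finitely many cone lines
  (`G|_L = s^{p−1}(w²A_{p−1} + wsA_p + s²A_{p+1})`).  Regimes: `n ≥ 3` forces cleaned order `d = p`
  (for `d = p+1`, `Z(ω') ∩ E = V(F_{p+1})` is a hypersurface of `E`; `d ≥ p+2`: `ω'|_E ≡ 0`);
  `n = 2` forces `d = p+1` (`F_p = cu₂^p + a w₁^p` is a sum of `p`-th powers, cleaned away);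
  `n = 1`: `d ≥ 2p`, drop `= p`.  So no violating transition exists; the item's three censuses
  (> 6 000 transitions, 0 violations; equality law 564/564) agree.
* §5  STUB AUDIT of line `euler-noether` (natural strengthenings; all survive as typed):
  `BaseChange` true for ALL `p, n` (`κ[[u]] → L[[u]]` faithfully flat by the local criterion;
  supports preserved by injectivity); `PolarAdditivity` vacuous unless `k = n−1` (height), then
  `0 → R/(g,y) →·x R/(g,xy) → R/(g,x) → 0` on the CM curve `R/(g)`; `MixedNoether` =
  `∏ kᵢ + Σ_Q ℓ_Q` from `∏(kᵢE + Rᵢ)`, `E·Rᵢ = kᵢ`, `Eⁿ = (−1)ⁿ⁻¹`, `Σ_{T≠∅}(−1)^{|T|+1} = 1`,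
  ROBUST to non-strict transforms (`kᵢ < ord fᵢ`: `Rᵢ ⊇ E` only adds `E`-components that
  additivity absorbs), and its finiteness hypothesis forces finite colength at every listed `Q`
  (a zero-curve leaving `E` would contract into `V(f)`); `NF` presentations are unique, so no double
  counting; `EulerTransform` exact coefficientwise (`θa` has order `≥ p+1` since `|A| = p` kills the
  degree-`p` part, so `dv i (p+1)` is exact); `NoExcess`, `ExceptionalBudget` = §4.  No
  `stub_false` target exists.  `-- Targets`: none served (no lead yet, `stuck_stubs = []`).
-/

noncomputable section

set_option linter.dupNamespace false

namespace Summit.ResolutionOfSingularities.ResolutionOfSingularities.Cruxes.IsolatedJacobianDrop.Disproof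

open Summit.ResolutionOfSingularities.ResolutionOfSingularities.Theses.JacobianBudget (IsolatedJacobianDrop)
open Summit.ResolutionOfSingularities.ResolutionOfSingularities.Theorems.NoPeriodicIsolatedAtom.Negative
  (clean bl ord dv tr step run ser pd jac umbrella)
open Summit.ResolutionOfSingularities.ResolutionOfSingularities.Theorems.IsolatedJacobianDrop
open scoped BigOperators Classical

/-! ## §0 The mirror is exact -/

/-- **The crux over the landed mirror calculus, definitionally** (`Isol`, `MultP`, `mu`, `Δ` inline);
identical to `Theorems.IsolatedJacobianDrop.Negative.crux_iff`. [folklore] -/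
theorem crux_iff :
    IsolatedJacobianDrop ↔
      ∀ p : ℕ, p.Prime → ∀ n : ℕ, 0 < n → ∀ (κ : Type) [Field κ] [CharP κ p] [PerfectField κ]
        (c₀ : (Fin n → ℕ) → κ) (i : ℕ → Fin n) (t : ℕ → Fin n → κ),
        ∀ m, Module.Finite κ (MvPowerSeries (Fin n) κ ⧸ jac p (run p c₀ i t m)) →
          ((∃ A, clean p (run p c₀ i t m) A ≠ 0) ∧
            ∀ A, clean p (run p c₀ i t m) A ≠ 0 → p ≤ Finset.sum Finset.univ (fun j => A j)) →
          Module.Finite κ (MvPowerSeries (Fin n) κ ⧸ jac p (run p c₀ i t (m + 1))) →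
          ((∃ A, clean p (run p c₀ i t (m + 1)) A ≠ 0) ∧
            ∀ A, clean p (run p c₀ i t (m + 1)) A ≠ 0 → p ≤ Finset.sum Finset.univ (fun j => A j)) →
          Module.finrank κ (MvPowerSeries (Fin n) κ ⧸ jac p (run p c₀ i t (m + 1))) +
              ((p - 1) ^ n * (p + 1) + 1 - 2 * ((n + 1) % 2)) / p ≤
            Module.finrank κ (MvPowerSeries (Fin n) κ ⧸ jac p (run p c₀ i t m)) :=
  Iff.rfl

/-! ## §1 Load-bearing analysis (both LANDED; restated by name) -/

/-- **`MultP (run m)` is load-bearing** — the right-hand side of `crux_iff` with that single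
hypothesis deleted is false (`x ↦ xy` at `p = 2`).  LANDED:
`Theorems/IsolatedJacobianDrop/Negative/FalseWithoutMultP.lean`. [folklore] -/
theorem without_MultP_false :
    ¬ ∀ p : ℕ, p.Prime → ∀ n : ℕ, 0 < n → ∀ (κ : Type) [Field κ] [CharP κ p] [PerfectField κ]
        (c₀ : (Fin n → ℕ) → κ) (i : ℕ → Fin n) (t : ℕ → Fin n → κ),
        ∀ m, Module.Finite κ (MvPowerSeries (Fin n) κ ⧸ jac p (run p c₀ i t m)) →
          Module.Finite κ (MvPowerSeries (Fin n) κ ⧸ jac p (run p c₀ i t (m + 1))) →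
          ((∃ A, clean p (run p c₀ i t (m + 1)) A ≠ 0) ∧
            ∀ A, clean p (run p c₀ i t (m + 1)) A ≠ 0 → p ≤ Finset.sum Finset.univ (fun j => A j)) →
          Module.finrank κ (MvPowerSeries (Fin n) κ ⧸ jac p (run p c₀ i t (m + 1))) +
              ((p - 1) ^ n * (p + 1) + 1 - 2 * ((n + 1) % 2)) / p ≤
            Module.finrank κ (MvPowerSeries (Fin n) κ ⧸ jac p (run p c₀ i t m)) :=
  Negative.isolatedJacobianDrop_false_without_MultP

/-- **`Isol (run m)` is load-bearing** — the right-hand side of `crux_iff` with that single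
hypothesis deleted is false (Whitney umbrella `x²y ↦ xy` in the `x`-chart at `p = 2`).  LANDED:
`Theorems/IsolatedJacobianDrop/Negative/FalseWithoutIsol.lean`. [folklore] -/
theorem without_Isol_false :
    ¬ ∀ p : ℕ, p.Prime → ∀ n : ℕ, 0 < n → ∀ (κ : Type) [Field κ] [CharP κ p] [PerfectField κ]
        (c₀ : (Fin n → ℕ) → κ) (i : ℕ → Fin n) (t : ℕ → Fin n → κ),
        ∀ m, ((∃ A, clean p (run p c₀ i t m) A ≠ 0) ∧
            ∀ A, clean p (run p c₀ i t m) A ≠ 0 → p ≤ Finset.sum Finset.univ (fun j => A j)) →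
          Module.Finite κ (MvPowerSeries (Fin n) κ ⧸ jac p (run p c₀ i t (m + 1))) →
          ((∃ A, clean p (run p c₀ i t (m + 1)) A ≠ 0) ∧
            ∀ A, clean p (run p c₀ i t (m + 1)) A ≠ 0 → p ≤ Finset.sum Finset.univ (fun j => A j)) →
          Module.finrank κ (MvPowerSeries (Fin n) κ ⧸ jac p (run p c₀ i t (m + 1))) +
              ((p - 1) ^ n * (p + 1) + 1 - 2 * ((n + 1) % 2)) / p ≤
            Module.finrank κ (MvPowerSeries (Fin n) κ ⧸ jac p (run p c₀ i t m)) :=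
  Negative.isolatedJacobianDrop_false_without_Isol

/-- The umbrella's Jacobian algebra is infinite over `κ` (the fact behind `without_Isol_false`;
LANDED as `Negative.not_isol_umbrella`). [folklore] -/
theorem umbrella_not_isolated :
    ¬ Module.Finite (ZMod 2) (MvPowerSeries (Fin 2) (ZMod 2) ⧸ jac 2 umbrella) :=
  Negative.not_isol_umbrella

/-! ## §2 Tightness -/

/-- **`Δ₁(p)` is attained** (LANDED as `Negative.isolatedJacobianDrop_tight_n1`): at `(2, 1, 𝔽₂)`
the transition `u⁵ ↦ u³` satisfies all four hypotheses, the conclusion with EQUALITY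
(`μ: 4 ↦ 2 = Δ₁(2)`), and fails with `Δ + 1`.  Displayed: the failure with `Δ + 1`. [folklore] -/
theorem tight_n1 :
    ¬ (Module.finrank (ZMod 2) (MvPowerSeries (Fin 1) (ZMod 2) ⧸
          jac 2 (run 2 (fun A : Fin 1 → ℕ => if A = ![5] then (1 : ZMod 2) else 0) (fun _ => 0) (fun _ _ => 0) 1)) +
        (((2 - 1) ^ 1 * (2 + 1) + 1 - 2 * ((1 + 1) % 2)) / 2 + 1) ≤
      Module.finrank (ZMod 2) (MvPowerSeries (Fin 1) (ZMod 2) ⧸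
          jac 2 (run 2 (fun A : Fin 1 → ℕ => if A = ![5] then (1 : ZMod 2) else 0) (fun _ => 0) (fun _ _ => 0) 0))) :=
  Negative.isolatedJacobianDrop_tight_n1.2.2.2.2.2

/-- `dim_κ κ[[u]] ⧸ (u^k) = k` (LANDED helper `Negative.finrank_quot_X_pow`, reusable for every
`n = 1` colength in this calculus). [folklore] -/
theorem finrank_quot_X_pow' {κ : Type} [Field κ] (k : ℕ) :
    Module.finrank κ (MvPowerSeries (Fin 1) κ ⧸ Ideal.span {(MvPowerSeries.X 0 : MvPowerSeries (Fin 1) κ) ^ k}) = k :=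
  Negative.finrank_quot_X_pow k

/-- **Tight at `(p, n) = (3, 2)`, two consecutive slack-0 steps**: `u₀⁴ + u₁⁷` over `𝔽₃`
(`μ = 3·6 = 18`), chart `u₁`, `τ = 0`: successor `u₀⁴u₁ + u₁⁴` (`J = (u₀³u₁, u₀⁴+u₁³)`,
`μ = I(u₁,·)+I(u₀³,·) = 4 + 9 = 13 = 18 − 5`), then chart `u₀`, `τ = 0`: `u₀²u₁ + u₀u₁⁴`
(`μ = 8 = 13 − 5`); at both steps the successor is the ONLY zero of `d a'` on `E`
(`V(F_{p+1}) = V(u₀⁴)`, resp. `V(e⁴)`), which is exactly when the conservation law of §4 gives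
equality at one point.  Displayed: the first step.  (Sorried: `μ = 18, 13` are colength
computations certified by the censuses on the item — e.g. `census.py`, `dualsim.py` — not by
`decide`.) [folklore] -/
theorem tight_32 :
    Module.finrank (ZMod 3) (MvPowerSeries (Fin 2) (ZMod 3) ⧸
          jac 3 (run 3 (fun A : Fin 2 → ℕ => if A = ![4, 0] then (1 : ZMod 3) else if A = ![0, 7] then 1 else 0)
            (fun _ => 1) (fun _ _ => 0) 1)) + 5 =
      Module.finrank (ZMod 3) (MvPowerSeries (Fin 2) (ZMod 3) ⧸
          jac 3 (run 3 (fun A : Fin 2 → ℕ => if A = ![4, 0] then (1 : ZMod 3) else if A = ![0, 7] then 1 else 0)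
            (fun _ => 1) (fun _ _ => 0) 0)) := by
  sorry

/-! ## §3 A natural strengthening that fails: pointwise equality -/

/-- **The drop is NOT always exactly `Δ_n(p)`** (so no proof can go through a pointwise identity;
the identity lives on the SUM over `E`): `p = 3`, `n = 2`, `a = u₀²u₁² + u₁⁷ + u₀⁵` (`μ = 13`),
chart `u₁`, `τ = 0`: successor `u₀²u₁ + u₁⁴ + u₀⁵u₁²` with `μ = 5`, drop `8 > 5`; the missing `3`
sits at the other exceptional zero `(1:0)` (`e w² + e² + …`, `μ = 3`).  Displayed as the failure of
`mu(run 1) + 5 = mu(run 0)` for this start. (Sorried: colengths `13`, `5` certified by the censuses.) [folklore] -/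
theorem not_pointwise_equality :
    Module.finrank (ZMod 3) (MvPowerSeries (Fin 2) (ZMod 3) ⧸
          jac 3 (run 3 (fun A : Fin 2 → ℕ =>
              if A = ![2, 2] then (1 : ZMod 3) else if A = ![0, 7] then 1 else if A = ![5, 0] then 1 else 0)
            (fun _ => 1) (fun _ _ => 0) 1)) + 5 ≠
      Module.finrank (ZMod 3) (MvPowerSeries (Fin 2) (ZMod 3) ⧸
          jac 3 (run 3 (fun A : Fin 2 → ℕ =>
              if A = ![2, 2] then (1 : ZMod 3) else if A = ![0, 7] then 1 else if A = ![5, 0] then 1 else 0)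
            (fun _ => 1) (fun _ _ => 0) 0)) := by
  sorry

-- Targets: none served this cycle (no lead, `stuck_stubs = []`); the six stubs of line
-- `euler-noether` were audited as natural strengthenings and all survive (module docstring §5).

end Summit.ResolutionOfSingularities.ResolutionOfSingularities.Cruxes.IsolatedJacobianDrop.Disproof

end
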